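import Summits.QuantumFields.YangMills.Theorems.F4SubCurvatureDoorSubCurvatureKernelGluedKernel
import Summits.QuantumFields.YangMills.Theorems.F4SubCurvatureDoorSubCurvatureKernelRepresentation
import Summits.QuantumFields.YangMills.Theorems.CheckerboardTrialityHyperoctahedralRung
import Summits.QuantumFields.YangMills.Theorems.PencilRigidityNPointIsotropyMopupHelpers
import Summits.QuantumFields.YangMills.Theorems.LangevinControlUVOSLegsAtWeakCouplingCStubLocalityReduction
import HarnessLib

/-!
# Route `F4SubCurvatureDoor`, crux `SubCurvatureKernel` ⟨stmt-QuantumFields-23036⟩ — REALITY and W(B₄)-SYMMETRY of the extracted kernel (a.e.), and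
# the representation clause with a REAL kernel (`K : ℝ⁴ → ℝ`, the crux's letter)

Helper file (`--supports stmt-QuantumFields-23036 --as helper`; free-hands seat `ym-line-frs-p2` g17, soft-half scope).  Definition-free, 0 sorry, standard axioms.
No item is closed; no summit, no crux and no mass gap is proved by this file.

WHAT.  The crux asks for a REAL kernel `K : ℝ⁴ → ℝ` (`S₁ 2 F = ∫ (K(x₀ − x₁) : ℂ) F`), W(B₄)-invariant.  Kernel-generically (uniqueness of difference
kernels ✓`ae_eq_of_repr_eq`, applied to truncations):
* `ae_conj_eq_of_real` — if `S₂` is REAL (`S₂ F̄ = conj (S₂ F)` on compactly supported off-diagonal `F`) then any representing kernel with the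
  `(1 + ‖u‖⁻¹)⁸` bound satisfies `conj K = K` a.e.;
* `ae_comp_eq_of_invariant` — if `S₂` is invariant under a linear isometry `R` on compactly supported off-diagonal test functions then `K ∘ R = K` a.e.
  (change of variables ✓`Mopup.integral_mul_linActMulti`);
and for leg-scheme limit points (under `MomentBounds6`):
* `conj_apply_of_offDiagLimitAlong` — reality of `S₁ n` on `⁰𝒮` (the lattice weights are real; uniqueness of limits);
* ★ `real_repr_of_offDiagLimitAlong` — a measurable REAL kernel `K : ℝ⁴ → ℝ`, `|K u| ≤ A (1 + ‖u‖⁻¹)⁸`, with `Integrable` and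
  `S₁ 2 F = ∫ (K(x₀ − x₁) : ℂ) F(x) dx` for EVERY off-diagonal `F` (clause 6 of the crux in its own letters), which is moreover a.e. invariant under every
  signed permutation of the axes (`∀ R, IsSignedPerm R → K ∘ R = K` a.e.; from the W(B₄) rung ✓`signedPerm_invariant_of_offDiagLimitAlong`).

HONEST LABEL: clauses 6 and (a.e. forms of) 2–3 of the SOFT half of ⟨23036⟩; the pointwise forms and clause 1 (continuity off `0`), clause 4 (pointwise RP,
from ✓p733252 after continuity) and clause 7 (✓p733727 after continuity) wait for (C); the SUB-CURVATURE clause (asymptotic freedom) is the crux, untouched;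
⟨23036⟩ is an open problem; the Yang–Mills mass gap is NOT proved; no summit is proved by a line.
-/

set_option autoImplicit false

noncomputable section

open scoped SchwartzMap BigOperators ContDiff ComplexConjugate
open MeasureTheory Filter Topology Set
open Literature.MathematicalPhysics.QuantumFieldTheory Literature.MathematicalPhysics.QuantumLattice
open Literature.MathematicalPhysics.AQFT
open Summit.QuantumFields.YangMills.Cruxes.OSLegsFromFemtoAndGap.DlrCollarTransfer (MomentBounds6)
open Summit.QuantumFields.YangMills.Cruxes.OSLegsAtWeakCouplingC.Sketch (Separated IsSignedPerm)
open Summit.QuantumFields.YangMills.Theorems.ROT (IsLegScheme OffDiagLimitAlong)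
open Summit.QuantumFields.YangMills.Theorems.NPointIsotropy.Negative (E4)
open Summit.QuantumFields.YangMills.Theorems.OSLegsFromFemtoAndGap (latticeDist latticeDist_apply)
open Summit.QuantumFields.YangMills.Theorems.OSLegsAtWeakCouplingC (linActMulti_hasCompactSupport tsupport_linActMulti_subset_separated)
open Summit.QuantumFields.YangMills.Theorems.NPointIsotropy.ComplexRotationBandlimit.Mopup (integral_mul_linActMulti)
open Summit.QuantumFields.YangMills.Theorems.F4SubCurvatureDoorSubCurvatureKernelExtraction (test_props)
open Summit.QuantumFields.YangMills.Theorems.F4SubCurvatureDoorSubCurvatureKernelGlued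
  (ae_eq_of_repr_eq volume_preimage_sub_eq_zero_iff exists_gluedKernel_of_offDiagLimitAlong)
open Summit.QuantumFields.YangMills.Theorems.F4SubCurvatureDoorSubCurvatureKernelRepr (repr_of_isOffDiagonal)
open Summit.QuantumFields.YangMills.Theorems.CheckerboardTrialityHyperoctahedral (signedPerm_invariant_of_offDiagLimitAlong)

namespace Summit.QuantumFields.YangMills.Theorems.F4SubCurvatureDoorSubCurvatureKernelSymmetries

/-! ## A kernel-generic uniqueness scheme for kernels with the `(1 + ‖u‖⁻¹)⁸` bound -/

/-- **From integral identities on every separated class to a.e. equality.**  If two measurable kernels with the `(1 + ‖u‖⁻¹)⁸` bound have the same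
integrals `∫ K(x₀ − x₁) G = ∫ K'(x₀ − x₁) G` against every compactly supported Schwartz `G` supported in some `Separated 2 δ`, they agree a.e. [folklore] -/
theorem ae_eq_of_integral_eq (K K' : E4 → ℂ) (hK : Measurable K) (hK' : Measurable K') {A : ℝ}
    (hKb : ∀ u, ‖K u‖ ≤ A * (1 + ‖u‖⁻¹) ^ 8) (hK'b : ∀ u, ‖K' u‖ ≤ A * (1 + ‖u‖⁻¹) ^ 8)
    (h : ∀ δ : ℝ, 0 < δ → ∀ G : 𝓢((Fin 2 → E4), ℂ), HasCompactSupport (G : (Fin 2 → E4) → ℂ) →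
      tsupport (G : (Fin 2 → E4) → ℂ) ⊆ Separated 2 δ →
        ∫ x : Fin 2 → E4, K (x 0 - x 1) * G x = ∫ x : Fin 2 → E4, K' (x 0 - x 1) * G x) :
    ∀ᵐ u : E4, K u = K' u := by
  classical
  have hA : 0 ≤ A := by
    have h1 := hKb 0; have h2 : (1 + ‖(0 : E4)‖⁻¹) ^ 8 = 1 := by simp
    rw [h2, mul_one] at h1; exact (norm_nonneg _).trans h1
  -- for each `δ > 0`: agreement a.e. on `{δ < ‖u‖}` via the truncated (bounded) kernels
  have hδ : ∀ δ : ℝ, 0 < δ → ∀ᵐ u : E4, δ < ‖u‖ → K u = K' u := by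
    intro δ hδ
    set T : (E4 → ℂ) → E4 → ℂ := fun L u => if δ < ‖u‖ then L u else 0 with hT
    have hTm : ∀ L : E4 → ℂ, Measurable L → Measurable (T L) := fun L hL =>
      Measurable.ite (measurableSet_lt measurable_const measurable_norm) hL measurable_const
    have hTb : ∀ L : E4 → ℂ, (∀ u, ‖L u‖ ≤ A * (1 + ‖u‖⁻¹) ^ 8) → ∀ u, ‖T L u‖ ≤ A * (1 + δ⁻¹) ^ 8 := by
      intro L hL u
      simp only [hT]
      split_ifs with hu
      · refine (hL u).trans (mul_le_mul_of_nonneg_left ?_ hA)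
        have : ‖u‖⁻¹ ≤ δ⁻¹ := by
          rw [inv_le_inv₀ (hδ.trans hu) hδ]; exact hu.le
        exact pow_le_pow_left₀ (by positivity) (by linarith) 8
      · rw [norm_zero]; positivity
    have hmain := ae_eq_of_repr_eq (T K) (T K') (hTm K hK) (hTm K' hK') (hTb K hKb) (hTb K' hK'b) δ ?_
    · refine hmain.mono fun u hu hδu => ?_
      have := hu hδu
      simpa only [hT, if_pos hδu] using this
    intro g hgs hgc hgU
    have hδ2 : 0 < δ / 2 := by positivity
    have hgU' : tsupport g ⊆ {x : Fin 2 → E4 | 2 * (δ / 2) < ‖x 0 - x 1‖} := by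
      intro x hx; have := hgU hx; simp only [mem_setOf_eq] at this ⊢; linarith
    obtain ⟨hc, hs, hsep, -⟩ := test_props hδ2 g hgs hgc hgU'
    set Gc : 𝓢((Fin 2 → E4), ℂ) := hc.toSchwartzMap hs with hGc
    have hGf : ∀ x, Gc x = ((g x : ℝ) : ℂ) := fun x => rfl
    have hsep' : tsupport (Gc : (Fin 2 → E4) → ℂ) ⊆ Separated 2 δ := by
      intro x hx; have := hsep hx; simpa [two_mul, add_halves] using this
    have hint := h δ hδ Gc hc hsep'
    -- on the support of `g` the truncation is invisible
    have hTK : ∀ (L : E4 → ℂ) (x : Fin 2 → E4), (g x : ℂ) * T L (x 0 - x 1) = (g x : ℂ) * L (x 0 - x 1) := by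
      intro L x
      by_cases hx : g x = 0
      · simp [hx]
      · have hxU : δ < ‖x 0 - x 1‖ := hgU (subset_tsupport _ hx)
        simp only [hT, if_pos hxU]
    calc ∫ x : Fin 2 → E4, g x • (T K (x 0 - x 1) - T K' (x 0 - x 1))
        = ∫ x : Fin 2 → E4, (K (x 0 - x 1) * Gc x - K' (x 0 - x 1) * Gc x) := by
          refine integral_congr_ae (Eventually.of_forall fun x => ?_)
          beta_reduce
          rw [Complex.real_smul, mul_sub, hTK K x, hTK K' x, hGf]; ring
      _ = 0 := by
          -- both integrands are integrable (bounded on the support of the compactly supported `Gc`)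
          have hI : ∀ (L : E4 → ℂ), Measurable L → (∀ u, ‖L u‖ ≤ A * (1 + ‖u‖⁻¹) ^ 8) →
              Integrable (fun x : Fin 2 → E4 => L (x 0 - x 1) * Gc x) := by
            intro L hL hLb
            have hGi : Integrable (fun x : Fin 2 → E4 => Gc x) := Gc.continuous.integrable_of_hasCompactSupport hc
            have hTi : Integrable (fun x : Fin 2 → E4 => T L (x 0 - x 1) * Gc x) :=
              hGi.bdd_mul (((hTm L hL).comp ((measurable_pi_apply 0).sub (measurable_pi_apply 1))).aestronglyMeasurable)
                (Eventually.of_forall fun x => hTb L hLb _)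
            refine hTi.congr (Eventually.of_forall fun x => ?_)
            show T L (x 0 - x 1) * Gc x = L (x 0 - x 1) * Gc x
            rw [hGf, mul_comm, hTK L x, mul_comm]
          rw [integral_sub (hI K hK hKb) (hI K' hK' hK'b), hint, sub_self]
  -- countably many scales and the null origin
  have hall : ∀ᵐ u : E4, ∀ n : ℕ, ((n : ℝ) + 1)⁻¹ < ‖u‖ → K u = K' u :=
    ae_all_iff.2 fun n => hδ _ (by positivity)
  have h0 : ∀ᵐ u : E4, u ≠ 0 := by
    rw [ae_iff]; simp
  filter_upwards [hall, h0] with u hu hu0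
  have hpos : 0 < ‖u‖ := norm_pos_iff.2 hu0
  obtain ⟨n, hn⟩ := exists_nat_gt ‖u‖⁻¹
  have hn' : ((n : ℝ) + 1)⁻¹ < ‖u‖ := by
    rw [inv_lt_comm₀ (by positivity) hpos]; linarith
  exact hu n hn'

/-- **Reality a.e.** of a representing kernel of a REAL functional. [folklore] -/
theorem ae_conj_eq_of_real (S₂ : 𝓢((Fin 2 → E4), ℂ) →L[ℂ] ℂ) (K : E4 → ℂ) (hKm : Measurable K) {A : ℝ}
    (hKb : ∀ u, ‖K u‖ ≤ A * (1 + ‖u‖⁻¹) ^ 8)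
    (hrep : ∀ δ : ℝ, 0 < δ → ∀ F : 𝓢((Fin 2 → E4), ℂ), HasCompactSupport (F : (Fin 2 → E4) → ℂ) →
      tsupport (F : (Fin 2 → E4) → ℂ) ⊆ Separated 2 δ →
        Integrable (fun x : Fin 2 → E4 => K (x 0 - x 1) * F x) ∧ S₂ F = ∫ x : Fin 2 → E4, K (x 0 - x 1) * F x)
    (hreal : ∀ F : 𝓢((Fin 2 → E4), ℂ), HasCompactSupport (F : (Fin 2 → E4) → ℂ) →
      (∃ δ : ℝ, 0 < δ ∧ tsupport (F : (Fin 2 → E4) → ℂ) ⊆ Separated 2 δ) → S₂ (starTest F) = conj (S₂ F)) :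
    ∀ᵐ u : E4, conj (K u) = K u := by
  have hcm : Measurable fun u => conj (K u) := Complex.continuous_conj.measurable.comp hKm
  have hcb : ∀ u, ‖conj (K u)‖ ≤ A * (1 + ‖u‖⁻¹) ^ 8 := fun u => by rw [Complex.norm_conj]; exact hKb u
  refine ae_eq_of_integral_eq (fun u => conj (K u)) K hcm hKm hcb hKb fun δ hδ G hGc hGs => ?_
  -- `∫ conj K · G = conj ∫ K · Ḡ = conj (S₂ Ḡ) = S₂ G = ∫ K · G`
  have hts : tsupport (starTest G : (Fin 2 → E4) → ℂ) = tsupport (G : (Fin 2 → E4) → ℂ) := by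
    have hsupp : Function.support (starTest G : (Fin 2 → E4) → ℂ) = Function.support (G : (Fin 2 → E4) → ℂ) := by
      ext x; simp [starTest_apply]
    rw [tsupport, tsupport, hsupp]
  have hGs' : tsupport (starTest G : (Fin 2 → E4) → ℂ) ⊆ Separated 2 δ := by rw [hts]; exact hGs
  have hGc' : HasCompactSupport (starTest G : (Fin 2 → E4) → ℂ) := by
    rw [HasCompactSupport, hts]; exact hGc
  obtain ⟨-, h1⟩ := hrep δ hδ G hGc hGs
  obtain ⟨-, h2⟩ := hrep δ hδ (starTest G) hGc' hGs'
  have h3 : S₂ G = conj (S₂ (starTest G)) := by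
    have h := hreal (starTest G) hGc' ⟨δ, hδ, hGs'⟩
    rwa [starTest_starTest] at h
  calc ∫ x : Fin 2 → E4, conj (K (x 0 - x 1)) * G x
      = ∫ x : Fin 2 → E4, conj (K (x 0 - x 1) * starTest G x) := by
        refine integral_congr_ae (Eventually.of_forall fun x => ?_)
        simp [starTest_apply, map_mul]
    _ = conj (∫ x : Fin 2 → E4, K (x 0 - x 1) * starTest G x) := integral_conj
    _ = conj (S₂ (starTest G)) := by rw [← h2]
    _ = S₂ G := h3.symm
    _ = ∫ x : Fin 2 → E4, K (x 0 - x 1) * G x := h1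

/-- **Invariance a.e.** of a representing kernel under a linear isometry leaving the functional invariant. [folklore] -/
theorem ae_comp_eq_of_invariant (S₂ : 𝓢((Fin 2 → E4), ℂ) →L[ℂ] ℂ) (K : E4 → ℂ) (hKm : Measurable K) {A : ℝ}
    (hKb : ∀ u, ‖K u‖ ≤ A * (1 + ‖u‖⁻¹) ^ 8)
    (hrep : ∀ δ : ℝ, 0 < δ → ∀ F : 𝓢((Fin 2 → E4), ℂ), HasCompactSupport (F : (Fin 2 → E4) → ℂ) →
      tsupport (F : (Fin 2 → E4) → ℂ) ⊆ Separated 2 δ →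
        Integrable (fun x : Fin 2 → E4 => K (x 0 - x 1) * F x) ∧ S₂ F = ∫ x : Fin 2 → E4, K (x 0 - x 1) * F x)
    (R : E4 ≃ₗᵢ[ℝ] E4)
    (hinv : ∀ F : 𝓢((Fin 2 → E4), ℂ), HasCompactSupport (F : (Fin 2 → E4) → ℂ) →
      (∃ δ : ℝ, 0 < δ ∧ tsupport (F : (Fin 2 → E4) → ℂ) ⊆ Separated 2 δ) → S₂ (linActMulti R F) = S₂ F) :
    ∀ᵐ u : E4, K (R u) = K u := by
  have hRm : Measurable fun u => K (R u) := hKm.comp R.continuous.measurable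
  have hRb : ∀ u, ‖K (R u)‖ ≤ A * (1 + ‖u‖⁻¹) ^ 8 := fun u => by
    have h := hKb (R u); rwa [R.norm_map] at h
  refine ae_eq_of_integral_eq (fun u => K (R u)) K hRm hKm hRb hKb fun δ hδ G hGc hGs => ?_
  have hRGc : HasCompactSupport (linActMulti R G : (Fin 2 → E4) → ℂ) := linActMulti_hasCompactSupport R hGc
  have hRGs : tsupport (linActMulti R G : (Fin 2 → E4) → ℂ) ⊆ Separated 2 δ := tsupport_linActMulti_subset_separated R hGs
  obtain ⟨-, h1⟩ := hrep δ hδ G hGc hGs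
  obtain ⟨-, h2⟩ := hrep δ hδ (linActMulti R G) hRGc hRGs
  calc ∫ x : Fin 2 → E4, K (R (x 0 - x 1)) * G x
      = ∫ x : Fin 2 → E4, K (x 0 - x 1) * linActMulti R G x := by
        rw [← integral_mul_linActMulti R (fun x : Fin 2 → E4 => K (x 0 - x 1)) G]
        refine integral_congr_ae (Eventually.of_forall fun x => ?_)
        simp only [map_sub]
    _ = S₂ (linActMulti R G) := h2.symm
    _ = S₂ G := hinv G hGc ⟨δ, hδ, hGs⟩
    _ = ∫ x : Fin 2 → E4, K (x 0 - x 1) * G x := h1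

/-! ## Leg-scheme limit points: reality, and the representation with a REAL, a.e. W(B₄)-invariant kernel -/

variable {G : Type} [Group G] [TopologicalSpace G] [IsTopologicalGroup G] [CompactSpace G]
  [MeasurableSpace G] [BorelSpace G]

/-- **Reality of leg-scheme limit points on `⁰𝒮`**: `S₁ n F̄ = conj (S₁ n F)` for off-diagonal `F`, `n ≥ 2` (the lattice weights are real; uniqueness of
limits). [folklore] -/
theorem conj_apply_of_offDiagLimitAlong (r : LatticeRep G) {sch : SpeciesScheme (YMSpecies G)} {φ : ℕ → ℕ}
    {S₁ : SchwingerFamily E4} (hS₁ : OffDiagLimitAlong r sch φ S₁) (n : ℕ) (hn : 2 ≤ n) (F : 𝓢((Fin n → E4), ℂ))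
    (hF : IsOffDiagonal F) : S₁ n (starTest F) = conj (S₁ n F) := by
  obtain ⟨-, -, hconv⟩ := hS₁
  have h1 := hconv n hn F hF
  have h2 := hconv n hn (starTest F) hF.starTest
  have hlat : ∀ j, latticeDist r.ρ (sch.β (φ j)) (sch.L (φ j)) (sch.a (φ j)) r.curvature.F
      (wilsonTorusMean r.ρ (sch.β (φ j)) (sch.L (φ j)) r.curvature.F) n (starTest F) =
      conj (latticeDist r.ρ (sch.β (φ j)) (sch.L (φ j)) (sch.a (φ j)) r.curvature.F
        (wilsonTorusMean r.ρ (sch.β (φ j)) (sch.L (φ j)) r.curvature.F) n F) := by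
    intro j
    rw [latticeDist_apply, latticeDist_apply, map_sum]
    refine Finset.sum_congr rfl fun x _ => ?_
    rw [starTest_apply, map_mul, Complex.conj_ofReal]
  have h3 : Tendsto (fun j => latticeDist r.ρ (sch.β (φ j)) (sch.L (φ j)) (sch.a (φ j)) r.curvature.F
      (wilsonTorusMean r.ρ (sch.β (φ j)) (sch.L (φ j)) r.curvature.F) n (starTest F)) atTop (𝓝 (conj (S₁ n F))) := by
    simp_rw [hlat]
    exact (Complex.continuous_conj.tendsto _).comp h1
  exact tendsto_nhds_unique h2 h3

/-- ★ **CLAUSE 6 WITH A REAL, a.e. W(B₄)-INVARIANT KERNEL.**  Under `MomentBounds6`, every off-diagonal limit point `S₁` of an admissible leg scheme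
has a measurable REAL kernel `K : ℝ⁴ → ℝ` with `|K u| ≤ A (1 + ‖u‖⁻¹)⁸`, representing `S₁ 2` on EVERY off-diagonal test function in the crux's letters
(`Integrable` and `S₁ 2 F = ∫ (K(x₀ − x₁) : ℂ) F`), and invariant a.e. under every signed permutation of the axes.
[cite: OS1973, §2] [cite: GlimmJaffe1987, §6.1] [cite: Rudin1987, Thm. 6.16] -/
theorem real_repr_of_offDiagLimitAlong (r : LatticeRep G) {a : ℝ → ℝ} (hapos : ∀ β, 0 < a β)
    (ha0 : Tendsto a atTop (𝓝 0)) (hMB : MomentBounds6 G r a) {sch : SpeciesScheme (YMSpecies G)}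
    (hsch : IsLegScheme a sch) {φ : ℕ → ℕ} (hφ : Tendsto φ atTop atTop) {S₁ : SchwingerFamily E4}
    (hS₁ : OffDiagLimitAlong r sch φ S₁) :
    ∃ K : E4 → ℝ, Measurable K ∧ (∃ A : ℝ, ∀ u, |K u| ≤ A * (1 + ‖u‖⁻¹) ^ 8) ∧
      (∀ F : 𝓢((Fin 2 → E4), ℂ), IsOffDiagonal F →
        Integrable (fun x : Fin 2 → E4 => (K (x 0 - x 1) : ℂ) * F x) ∧ S₁ 2 F = ∫ x : Fin 2 → E4, (K (x 0 - x 1) : ℂ) * F x) ∧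
      ∀ R : E4 ≃ₗᵢ[ℝ] E4, IsSignedPerm R → ∀ᵐ u : E4, K (R u) = K u := by
  obtain ⟨Kc, hKm, ⟨A, hA⟩, hrep⟩ := exists_gluedKernel_of_offDiagLimitAlong r hapos ha0 hMB hsch hφ hS₁
  have hA0 : 0 ≤ A := by
    have h1 := hA 0; have h2 : (1 + ‖(0 : E4)‖⁻¹) ^ 8 = 1 := by simp
    rw [h2, mul_one] at h1; exact (norm_nonneg _).trans h1
  -- reality a.e. of the complex kernel
  have hreal : ∀ F : 𝓢((Fin 2 → E4), ℂ), HasCompactSupport (F : (Fin 2 → E4) → ℂ) →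
      (∃ δ : ℝ, 0 < δ ∧ tsupport (F : (Fin 2 → E4) → ℂ) ⊆ Separated 2 δ) → S₁ 2 (starTest F) = conj (S₁ 2 F) := by
    intro F _ ⟨δ, hδ, hFs⟩
    refine conj_apply_of_offDiagLimitAlong r hS₁ 2 le_rfl F (IsOffDiagonal.of_tsupport_subset fun y hy hco => ?_)
    obtain ⟨i, j, hij, hyij⟩ := (mem_coincidenceLocus y).1 hco
    have h : δ ≤ dist (y i) (y j) := hFs hy i j hij
    rw [hyij, dist_self] at h
    exact absurd h (not_le.2 hδ)
  have hconj : ∀ᵐ u : E4, conj (Kc u) = Kc u := ae_conj_eq_of_real (S₁ 2) Kc hKm hA hrep hreal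
  -- the real kernel
  set K : E4 → ℝ := fun u => (Kc u).re with hK
  have hKmeas : Measurable K := Complex.measurable_re.comp hKm
  have hKb : ∀ u, |K u| ≤ A * (1 + ‖u‖⁻¹) ^ 8 := fun u => (Complex.abs_re_le_norm _).trans (hA u)
  have hKae : ∀ᵐ u : E4, (K u : ℂ) = Kc u := hconj.mono fun u hu => by
    simp only [hK]
    exact Complex.conj_eq_iff_re.1 hu
  -- pull the a.e. equality back to configurations
  have hKae' : ∀ᵐ x : Fin 2 → E4, (K (x 0 - x 1) : ℂ) = Kc (x 0 - x 1) := by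
    set N : Set E4 := {u | (K u : ℂ) ≠ Kc u} with hN
    have hNm : MeasurableSet N := (measurableSet_eq_fun (Complex.measurable_ofReal.comp hKmeas) hKm).compl
    have hN0 : volume N = 0 := by
      have := ae_iff.1 hKae; simpa [hN] using this
    have hpre := (volume_preimage_sub_eq_zero_iff N hNm).2 hN0
    rw [ae_iff]; simpa [hN] using hpre
  refine ⟨K, hKmeas, ⟨A, hKb⟩, fun F hF => ?_, fun R hR => ?_⟩
  · obtain ⟨hI, hS⟩ := repr_of_isOffDiagonal (S₁ 2) Kc hKm hA0 hA hrep F hF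
    have hae : (fun x : Fin 2 → E4 => (K (x 0 - x 1) : ℂ) * F x) =ᵐ[volume] fun x => Kc (x 0 - x 1) * F x :=
      hKae'.mono fun x hx => by beta_reduce; rw [hx]
    exact ⟨hI.congr hae.symm, by rw [hS]; exact (integral_congr_ae hae).symm⟩
  · have hinv : ∀ F : 𝓢((Fin 2 → E4), ℂ), HasCompactSupport (F : (Fin 2 → E4) → ℂ) →
        (∃ δ : ℝ, 0 < δ ∧ tsupport (F : (Fin 2 → E4) → ℂ) ⊆ Separated 2 δ) → S₁ 2 (linActMulti R F) = S₁ 2 F := by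
      intro F _ ⟨δ, hδ, hFs⟩
      refine signedPerm_invariant_of_offDiagLimitAlong r hapos ha0 hMB hsch hφ hS₁ R hR 2 F
        (IsOffDiagonal.of_tsupport_subset fun y hy hco => ?_)
      obtain ⟨i, j, hij, hyij⟩ := (mem_coincidenceLocus y).1 hco
      have h : δ ≤ dist (y i) (y j) := hFs hy i j hij
      rw [hyij, dist_self] at h
      exact absurd h (not_le.2 hδ)
    have hc := ae_comp_eq_of_invariant (S₁ 2) Kc hKm hA hrep R hinv
    exact hc.mono fun u hu => by simp only [hK, hu]

end Summit.QuantumFields.YangMills.Theorems.F4SubCurvatureDoorSubCurvatureKernelSymmetries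

end
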